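import Literature.NumberTheory.EllipticCurves.ShintaniIndefiniteStabilizersB
import HarnessLib

/-!
# Stabilisers of split indefinite vectors (square discriminant) in `Γ₀(64)⁺` are trivial

[[cite: Shintani1975, §2, proof of Prop. 2.3 (p. 104)]] — for the twisted lift on `Γ₀(64)⁺`
the indefinite vectors `k₀` with SQUARE discriminant `Δ(k₀) = m₀² > 0` (forms with rational
roots, i.e. pairs of cusps) have TRIVIAL stabiliser, so their orbit integrals are integrals over
all of `ℍ` (cusp-to-cusp periods).  We PROVE:

* `eq_one_or_neg_one_of_two_rat_fixed` — an element of `SL₂(ℤ)` with two distinct rational fixed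
  points is `±1` (`(p+s)² - 4` a square forces `|p+s| = 2`);
* `exists_conj_cols` — the conjugating matrix to `λXY` with its columns pointing to the roots
  `(-x₁ ∓ √Δ)/(2x₀)`; `fixed_of_conj_diag` — diagonal conjugate ⇒ fixed-point relations;
* **`eq_one_of_smul_eq_of_sq`** — `γ ∈ Γ₀(64)⁺`, `γ • k₀ = k₀`, `Δ(k₀) = m₀² > 0 ⇒ γ = 1`;
  `stabK_eq_bot_of_sq`.

No named facts, no new definitions.
-/

noncomputable section

open scoped MatrixGroups
open UpperHalfPlane hiding I
open Complex CongruenceSubgroup ModularGroup Real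
open Literature.NumberTheory.EllipticCurves.ModularForms

namespace Literature.NumberTheory.EllipticCurves.Shintani

/-! ### An element of `SL₂(ℤ)` with two distinct rational fixed points is `±1` -/

/-- An integer that is the square of a rational is the square of an integer. [folklore] -/
theorem exists_int_sq_of_rat_sq {n : ℤ} {t : ℚ} (h : (t : ℚ) ^ 2 = n) : ∃ m : ℤ, m ^ 2 = n := by
  have hsq : IsSquare (n : ℚ) := ⟨t, by rw [← h]; ring⟩
  rw [Rat.isSquare_intCast_iff] at hsq
  obtain ⟨m, hm⟩ := hsq
  exact ⟨m, by rw [hm]; ring⟩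

/-- `(p+s)² - 4` is a perfect square only for `|p + s| = 2`. [folklore] -/
theorem abs_eq_two_of_sq_sub_four_sq {u m : ℤ} (h : m ^ 2 = u ^ 2 - 4) : u = 2 ∨ u = -2 := by
  have h1 : (u - m) * (u + m) = 4 := by nlinarith
  have hbound : |u - m| ≤ 4 := by
    have : |u - m| ∣ 4 := by
      rw [← h1, abs_dvd]; exact dvd_mul_right _ _
    exact Int.le_of_dvd (by norm_num) this
  have hbound' : |u + m| ≤ 4 := by
    have : |u + m| ∣ 4 := by
      rw [← h1, abs_dvd]; exact dvd_mul_left _ _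
    exact Int.le_of_dvd (by norm_num) this
  rw [abs_le] at hbound hbound'
  have : u - m ≤ 4 ∧ -4 ≤ u - m ∧ u + m ≤ 4 ∧ -4 ≤ u + m := ⟨hbound.2, hbound.1, hbound'.2, hbound'.1⟩
  -- finitely many cases
  rcases this with ⟨h2, h3, h4, h5⟩
  interval_cases hum : (u - m) <;> omega

/-- **An element of `SL₂(ℤ)` fixing two distinct rational points** (fixed-point relations in
cross-multiplied form) **is `±1`.** [folklore] -/
theorem eq_one_or_neg_one_of_two_rat_fixed {γ : SL(2, ℤ)} {ξ η : ℚ} (hne : ξ ≠ η)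
    (hξ : ((γ 0 0 : ℚ) * ξ + γ 0 1) = ξ * ((γ 1 0 : ℚ) * ξ + γ 1 1))
    (hη : ((γ 0 0 : ℚ) * η + γ 0 1) = η * ((γ 1 0 : ℚ) * η + γ 1 1)) :
    γ = 1 ∨ γ = -1 := by
  have hdet := det_eq_one' γ
  have hdetQ : (γ 0 0 : ℚ) * γ 1 1 - γ 0 1 * γ 1 0 = 1 := by exact_mod_cast hdet
  by_cases hr : (γ 1 0 : ℤ) = 0
  · -- `r = 0`: `p s = 1`, `p = s = ±1`, then `q = 0`
    rw [hr, mul_zero, sub_zero] at hdet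
    have hrQ : (γ 1 0 : ℚ) = 0 := by exact_mod_cast hr
    rcases Int.eq_one_or_neg_one_of_mul_eq_one hdet with hp | hp
    · have hs : (γ 1 1 : ℤ) = 1 := by rw [hp] at hdet; linarith
      have hq : (γ 0 1 : ℤ) = 0 := by
        have hpQ : (γ 0 0 : ℚ) = 1 := by exact_mod_cast hp
        have hsQ : (γ 1 1 : ℚ) = 1 := by exact_mod_cast hs
        rw [hrQ, hpQ, hsQ] at hξ
        have : (γ 0 1 : ℚ) = 0 := by linarith
        exact_mod_cast this
      left; ext i j; fin_cases i <;> fin_cases j <;> simp [hp, hq, hr, hs]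
    · have hs : (γ 1 1 : ℤ) = -1 := by rw [hp] at hdet; linarith
      have hq : (γ 0 1 : ℤ) = 0 := by
        have hpQ : (γ 0 0 : ℚ) = -1 := by exact_mod_cast hp
        have hsQ : (γ 1 1 : ℚ) = -1 := by exact_mod_cast hs
        rw [hrQ, hpQ, hsQ] at hξ
        have : (γ 0 1 : ℚ) = 0 := by linarith
        exact_mod_cast this
      right; ext i j; fin_cases i <;> fin_cases j <;> simp [hp, hq, hr, hs]
  · -- `r ≠ 0`: both fixed points are roots of `r t² + (s - p) t - q = 0`
    exfalso
    have hrQ : (γ 1 0 : ℚ) ≠ 0 := by exact_mod_cast hr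
    have e1 : (γ 1 0 : ℚ) * ξ ^ 2 + ((γ 1 1 : ℚ) - γ 0 0) * ξ - γ 0 1 = 0 := by linear_combination -hξ
    have e2 : (γ 1 0 : ℚ) * η ^ 2 + ((γ 1 1 : ℚ) - γ 0 0) * η - γ 0 1 = 0 := by linear_combination -hη
    -- `r (ξ + η) = p - s` (subtract and divide by `ξ - η`) and then `(r(ξ - η))² = (p+s)² - 4`
    have hsum : (γ 1 0 : ℚ) * (ξ + η) = (γ 0 0 : ℚ) - γ 1 1 := by
      have h := sub_ne_zero.mpr hne
      have : ((γ 1 0 : ℚ) * (ξ + η) - ((γ 0 0 : ℚ) - γ 1 1)) * (ξ - η) = 0 := by linear_combination e1 - e2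
      rcases mul_eq_zero.mp this with h1 | h1
      · linarith
      · exact absurd h1 h
    have hprod : (γ 1 0 : ℚ) * (ξ * η) = -(γ 0 1 : ℚ) := by
      have h := sub_ne_zero.mpr hne
      have : ((γ 1 0 : ℚ) * (ξ * η) + (γ 0 1 : ℚ)) * (ξ - η) = 0 := by linear_combination η * e1 - ξ * e2
      rcases mul_eq_zero.mp this with h1 | h1
      · linarith
      · exact absurd h1 h
    -- `t = r (ξ - η)` has `t² = (p + s)² - 4`
    set t : ℚ := (γ 1 0 : ℚ) * (ξ - η) with ht
    have ht2 : t ^ 2 = (((γ 0 0 : ℤ) + γ 1 1) ^ 2 - 4 : ℤ) := by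
      push_cast
      have : t ^ 2 = ((γ 1 0 : ℚ) * (ξ + η)) ^ 2 - 4 * (γ 1 0 : ℚ) * ((γ 1 0 : ℚ) * (ξ * η)) := by
        rw [ht]; ring
      rw [this, hsum, hprod]
      linear_combination (-4 : ℚ) * hdetQ
    obtain ⟨m, hm⟩ := exists_int_sq_of_rat_sq ht2
    rcases abs_eq_two_of_sq_sub_four_sq hm with hu | hu
    · have : t ^ 2 = 0 := by rw [ht2, hu]; norm_num
      have ht0 : t = 0 := pow_eq_zero_iff two_ne_zero |>.mp this
      rw [ht] at ht0
      rcases mul_eq_zero.mp ht0 with h1 | h1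
      · exact hrQ h1
      · exact hne (sub_eq_zero.mp h1)
    · have : t ^ 2 = 0 := by rw [ht2, hu]; norm_num
      have ht0 : t = 0 := pow_eq_zero_iff two_ne_zero |>.mp this
      rw [ht] at ht0
      rcases mul_eq_zero.mp ht0 with h1 | h1
      · exact hrQ h1
      · exact hne (sub_eq_zero.mp h1)

/-! ### Split vectors: the columns of the conjugating matrix point to the rational roots -/

/-- The conjugating matrix of `ShintaniMoebiusTransport.exists_conj_to_xyForm` for `x₀ ≠ 0`, with
its columns: `c ≠ 0`, `d ≠ 0`, and `a/c = (-x₁ - √Δ)/(2x₀)`, `b/d = (-x₁ + √Δ)/(2x₀)` are the two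
roots. [folklore] -/
theorem exists_conj_cols {x : V} (hx0 : x 0 ≠ 0) (hdisc : 0 < disc x) :
    ∃ (a b c d lam : ℝ), a * d - b * c = 1 ∧ lam ≠ 0 ∧ actV a b c d x = xyForm lam ∧ c ≠ 0 ∧ d ≠ 0 ∧
      a / c = (-x 1 - Real.sqrt (disc x)) / (2 * x 0) ∧ b / d = (-x 1 + Real.sqrt (disc x)) / (2 * x 0) := by
  set s : ℝ := Real.sqrt (disc x) with hs
  have hs2 : s ^ 2 = disc x := Real.sq_sqrt hdisc.le
  have hspos : 0 < s := Real.sqrt_pos.mpr hdisc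
  set ξ₁ : ℝ := (-x 1 - s) / (2 * x 0) with hξ₁
  set ξ₂ : ℝ := (-x 1 + s) / (2 * x 0) with hξ₂
  have hd : disc x = x 1 ^ 2 - 4 * x 0 * x 2 := rfl
  have hroot : ∀ ξ : ℝ, (ξ = ξ₁ ∨ ξ = ξ₂) → x 0 * ξ ^ 2 + x 1 * ξ + x 2 = 0 := by
    intro ξ hξ
    rcases hξ with rfl | rfl
    · rw [hξ₁]; field_simp; linear_combination hs2 + hd
    · rw [hξ₂]; field_simp; linear_combination hs2 + hd
  have hdiff : ξ₂ - ξ₁ = s / x 0 := by rw [hξ₁, hξ₂]; field_simp; ring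
  have hdne : ξ₂ - ξ₁ ≠ 0 := by rw [hdiff]; exact div_ne_zero hspos.ne' hx0
  set δ : ℝ := ξ₂ - ξ₁ with hδ
  refine ⟨-ξ₁, ξ₂ / δ, -1, 1 / δ, actV (-ξ₁) (ξ₂ / δ) (-1) (1 / δ) x 1, ?_, ?_, ?_, by norm_num,
    one_div_ne_zero hdne, by ring, by field_simp⟩
  · field_simp; ring
  · intro h0
    have hd' := disc_actV (-ξ₁) (ξ₂ / δ) (-1) (1 / δ) x
    have hdet' : (-ξ₁) * (1 / δ) - ξ₂ / δ * (-1) = 1 := by field_simp; ring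
    rw [hdet', one_pow, one_mul] at hd'
    have h0' : actV (-ξ₁) (ξ₂ / δ) (-1) (1 / δ) x 0 = 0 := by
      rw [actV_zero]; have := hroot ξ₁ (Or.inl rfl); nlinarith [this]
    rw [disc, h0, h0'] at hd'
    simp at hd'
    linarith
  · have h0' : actV (-ξ₁) (ξ₂ / δ) (-1) (1 / δ) x 0 = 0 := by
      rw [actV_zero]; have := hroot ξ₁ (Or.inl rfl); nlinarith [this]
    have h2' : actV (-ξ₁) (ξ₂ / δ) (-1) (1 / δ) x 2 = 0 := by
      rw [actV_two]; have := hroot ξ₂ (Or.inr rfl); field_simp; nlinarith [this]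
    ext i
    fin_cases i
    · simpa [xyForm] using h0'
    · simp [xyForm]
    · simpa [xyForm] using h2'

/-- **From a diagonal conjugate to fixed-point relations**: if `M⁻¹ g M` has vanishing
off-diagonal entries then `g` fixes `a/c` and `b/d` (columns of `M`), in cross-multiplied form.
[folklore] -/
theorem fixed_of_conj_diag {M g : SL(2, ℝ)} (hc0 : (M 1 0 : ℝ) ≠ 0) (hd0 : (M 1 1 : ℝ) ≠ 0)
    (h10 : ((M⁻¹ * g * M) 1 0 : ℝ) = 0) (h01 : ((M⁻¹ * g * M) 0 1 : ℝ) = 0) :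
    ((g 0 0 : ℝ) * (M 0 0 / M 1 0) + g 0 1) = (M 0 0 / M 1 0) * ((g 1 0 : ℝ) * (M 0 0 / M 1 0) + g 1 1) ∧
    ((g 0 0 : ℝ) * (M 0 1 / M 1 1) + g 0 1) = (M 0 1 / M 1 1) * ((g 1 0 : ℝ) * (M 0 1 / M 1 1) + g 1 1) := by
  set δ : SL(2, ℝ) := M⁻¹ * g * M with hδ
  have hgM : g * M = M * δ := by rw [hδ]; group
  have e : ∀ i j, ((g * M) i j : ℝ) = ((M * δ) i j : ℝ) := fun i j ↦ by rw [hgM]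
  have egM : ∀ i j, ((g * M) i j : ℝ) = g i 0 * M 0 j + g i 1 * M 1 j := by
    intro i j; simp [Matrix.mul_apply, Fin.sum_univ_two]
  have eMδ : ∀ i j, ((M * δ) i j : ℝ) = M i 0 * δ 0 j + M i 1 * δ 1 j := by
    intro i j; simp [Matrix.mul_apply, Fin.sum_univ_two]
  have c00 := e 0 0; have c10 := e 1 0; have c01 := e 0 1; have c11 := e 1 1
  rw [egM, eMδ, h10, mul_zero, add_zero] at c00 c10
  rw [egM, eMδ, h01, mul_zero, zero_add] at c01 c11
  constructor
  · field_simp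
    linear_combination (M 1 0 : ℝ) * c00 - (M 0 0 : ℝ) * c10
  · field_simp
    linear_combination (M 1 1 : ℝ) * c01 - (M 0 1 : ℝ) * c11

/-- **The stabiliser of a split vector is trivial**: for `k₀` with `Δ(k₀) = m₀²`, `m₀ > 0`,
every `γ ∈ Γ₀(64)⁺` with `γ • k₀ = k₀` is `1`. [cite: Shintani1975, §2, proof of Prop. 2.3] -/
theorem eq_one_of_smul_eq_of_sq {k₀ : Fin 3 → ℤ} {m₀ : ℤ} (hm₀ : 0 < m₀) (hΔ : intDisc k₀ = m₀ ^ 2)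
    {γ : Gamma0Plus 64} (hγ : γ • k₀ = k₀) : γ = 1 := by
  set x : V := latSharp k₀ with hxdef
  have hdiscR : disc x = ((m₀ : ℝ)) ^ 2 := by
    rw [disc_latSharp_eq_intDisc, hΔ]; push_cast; ring
  have hpos : 0 < disc x := by
    rw [hdiscR]; exact pow_pos (by exact_mod_cast hm₀) 2
  have hsqrt : Real.sqrt (disc x) = m₀ := by
    rw [hdiscR, Real.sqrt_sq (by exact_mod_cast hm₀.le)]
  have hg : actSL (((γ : SL(2, ℤ))) : SL(2, ℝ)) x = x := (smul_eq_iff_actSL γ k₀).mp hγ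
  set g : SL(2, ℤ) := (γ : SL(2, ℤ)) with hgdef
  -- the rational conclusion `g = ±1` gives `γ = 1`
  suffices hpm : g = 1 ∨ g = -1 by
    rcases hpm with h1 | h1
    · exact Subtype.ext h1
    · exfalso; have hmem := γ.2; rw [← hgdef, h1] at hmem; exact neg_one_not_mem_Gamma0Plus hmem
  have hdet := det_eq_one' g
  by_cases hx0 : x 0 = 0
  · -- `x = (0, k₁, k₂)` with `k₁ ≠ 0`: `(k₁ k₂) g = (k₁ k₂)` forces `g = ±1` directly
    have hk0 : k₀ 0 = 0 := by
      have : (64 : ℝ) * (k₀ 0 : ℝ) = 0 := by rw [← latSharp_zero]; exact hx0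
      exact_mod_cast (mul_eq_zero.mp this).resolve_left (by norm_num)
    have hk1 : k₀ 1 ≠ 0 := by
      intro h1; rw [intDisc, hk0, h1] at hΔ; nlinarith
    -- integer identities from `actM g x = x`
    have hgx : actM g x = x := by rw [← actSL_coe]; exact hg
    have c0 := congrFun (congrArg (fun v : V ↦ (v : Fin 3 → ℝ)) hgx) 0
    have c1 := congrFun (congrArg (fun v : V ↦ (v : Fin 3 → ℝ)) hgx) 1
    have c2 := congrFun (congrArg (fun v : V ↦ (v : Fin 3 → ℝ)) hgx) 2
    simp [actM, actV, hxdef, latSharp, hk0] at c0 c1 c2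
    -- `r (Bp + Cr) = 0`, `B(ps+qr) + 2Crs = B`, `Bqs + Cs² = C` over `ℝ`, hence over `ℤ`
    have i0 : (g 1 0 : ℤ) * (k₀ 1 * g 0 0 + k₀ 2 * g 1 0) = 0 := by
      have : ((g 1 0 : ℤ) : ℝ) * ((k₀ 1 : ℝ) * (g 0 0 : ℤ) + (k₀ 2 : ℝ) * (g 1 0 : ℤ)) = 0 := by nlinarith [c0]
      exact_mod_cast this
    have i1 : (k₀ 1 : ℤ) * (g 0 0 * g 1 1 + g 0 1 * g 1 0) + 2 * k₀ 2 * g 1 0 * g 1 1 = k₀ 1 := by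
      have : ((k₀ 1 : ℤ) : ℝ) * ((g 0 0 : ℤ) * (g 1 1 : ℤ) + (g 0 1 : ℤ) * (g 1 0 : ℤ)) +
          2 * (k₀ 2 : ℝ) * (g 1 0 : ℤ) * (g 1 1 : ℤ) = k₀ 1 := by nlinarith [c1]
      exact_mod_cast this
    have i2 : (k₀ 1 : ℤ) * g 0 1 * g 1 1 + k₀ 2 * g 1 1 ^ 2 = k₀ 2 := by
      have : ((k₀ 1 : ℤ) : ℝ) * (g 0 1 : ℤ) * (g 1 1 : ℤ) + (k₀ 2 : ℝ) * ((g 1 1 : ℤ) : ℝ) ^ 2 = k₀ 2 := by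
        nlinarith [c2]
      exact_mod_cast this
    by_cases hr : (g 1 0 : ℤ) = 0
    · rw [hr] at hdet i1
      simp only [mul_zero, sub_zero, add_zero] at hdet i1
      rcases Int.eq_one_or_neg_one_of_mul_eq_one hdet with hp | hp
      · have hs : (g 1 1 : ℤ) = 1 := by rw [hp] at hdet; linarith
        have hq : (g 0 1 : ℤ) = 0 := by
          rw [hs] at i2; have : (k₀ 1 : ℤ) * g 0 1 = 0 := by nlinarith
          exact (mul_eq_zero.mp this).resolve_left hk1
        left; ext i j; fin_cases i <;> fin_cases j <;> simp [hp, hq, hr, hs]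
      · have hs : (g 1 1 : ℤ) = -1 := by rw [hp] at hdet; linarith
        have hq : (g 0 1 : ℤ) = 0 := by
          rw [hs] at i2; have : (k₀ 1 : ℤ) * g 0 1 = 0 := by nlinarith
          exact (mul_eq_zero.mp this).resolve_left hk1
        right; ext i j; fin_cases i <;> fin_cases j <;> simp [hp, hq, hr, hs]
    · exfalso
      have hBp : (k₀ 1 : ℤ) * g 0 0 + k₀ 2 * g 1 0 = 0 := (mul_eq_zero.mp i0).resolve_left hr
      have hBq : (k₀ 1 : ℤ) * g 0 1 + k₀ 2 * g 1 1 = 0 := by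
        have hqr : (g 0 1 : ℤ) * g 1 0 = g 0 0 * g 1 1 - 1 := by linarith
        have : 2 * (g 1 0 : ℤ) * (k₀ 1 * g 0 1 + k₀ 2 * g 1 1) = 0 := by
          linear_combination i1 + (k₀ 1 : ℤ) * hqr
        rcases mul_eq_zero.mp this with h | h
        · rcases mul_eq_zero.mp h with h' | h'
          · norm_num at h'
          · exact absurd h' hr
        · exact h
      -- `(k₁, k₂) g = 0` with `g` invertible forces `k₁ = 0`
      have : (k₀ 1 : ℤ) * (g 0 0 * g 1 1 - g 0 1 * g 1 0) = 0 := by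
        linear_combination (g 1 1 : ℤ) * hBp - (g 1 0 : ℤ) * hBq
      rw [hdet, mul_one] at this
      exact hk1 this
  · -- `x₀ ≠ 0`: the columns of the conjugating matrix are the rational roots
    obtain ⟨a, b, c, d, lam, hdet', hlam, hconj, hc0, hd0, hcol1, hcol2⟩ := exists_conj_cols hx0 hpos
    set M : SL(2, ℝ) := slOf a b c d hdet' with hMdef
    have hM : actSL M x = xyForm lam := by rw [hMdef, actSL_slOf]; exact hconj
    obtain ⟨h10, h01⟩ := (actSL_eq_iff_conj hlam hM ((g : SL(2, ℤ)) : SL(2, ℝ))).mp hg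
    have hfix := fixed_of_conj_diag (M := M) (g := ((g : SL(2, ℤ)) : SL(2, ℝ)))
      (by simpa [hMdef, slOf] using hc0) (by simpa [hMdef, slOf] using hd0) h10 h01
    have hMc : (M 0 0 : ℝ) / M 1 0 = a / c := by simp [hMdef, slOf]
    have hMd : (M 0 1 : ℝ) / M 1 1 = b / d := by simp [hMdef, slOf]
    rw [hMc, hMd, hcol1, hcol2, hsqrt] at hfix
    -- the roots as rationals
    have hx0Q : (128 * k₀ 0 : ℚ) ≠ 0 := by
      have : (64 : ℝ) * (k₀ 0 : ℝ) ≠ 0 := by rw [← latSharp_zero]; exact hx0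
      have : (k₀ 0 : ℝ) ≠ 0 := by intro h; apply this; rw [h, mul_zero]
      have : (k₀ 0 : ℚ) ≠ 0 := by exact_mod_cast (show (k₀ 0 : ℤ) ≠ 0 by exact_mod_cast this)
      positivity
    set ξ : ℚ := (-(k₀ 1 : ℚ) - m₀) / (128 * k₀ 0) with hξ
    set η : ℚ := (-(k₀ 1 : ℚ) + m₀) / (128 * k₀ 0) with hη
    have hξR : ((ξ : ℚ) : ℝ) = (-x 1 - m₀) / (2 * x 0) := by
      rw [hξ, hxdef, latSharp_zero, latSharp_one]; push_cast; ring
    have hηR : ((η : ℚ) : ℝ) = (-x 1 + m₀) / (2 * x 0) := by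
      rw [hη, hxdef, latSharp_zero, latSharp_one]; push_cast; ring
    rw [← hξR, ← hηR] at hfix
    have hne : ξ ≠ η := by
      intro h
      have : (2 * m₀ : ℚ) / (128 * k₀ 0) = 0 := by
        have := congrArg (fun t : ℚ ↦ η - t) h
        simp only [sub_self] at this
        rw [← this, hξ, hη]; ring
      rw [div_eq_zero_iff] at this
      rcases this with h1 | h1
      · have : (m₀ : ℚ) = 0 := by linarith
        have : m₀ = 0 := by exact_mod_cast this
        omega
      · exact hx0Q h1
    have hcast : ∀ i j, ((((g : SL(2, ℤ)) : SL(2, ℝ)) i j : ℝ)) = (((g i j : ℤ) : ℚ) : ℝ) := by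
      intro i j; rw [Rat.cast_intCast]; simp [Matrix.SpecialLinearGroup.map_apply_coe]
    rw [hcast 0 0, hcast 0 1, hcast 1 0, hcast 1 1] at hfix
    obtain ⟨hf1, hf2⟩ := hfix
    refine eq_one_or_neg_one_of_two_rat_fixed hne ?_ ?_
    · exact_mod_cast hf1
    · exact_mod_cast hf2

/-- **`Γ_{k₀} = 1` for split `k₀`.** [cite: Shintani1975, §2, proof of Prop. 2.3] -/
theorem stabK_eq_bot_of_sq {k₀ : Fin 3 → ℤ} {m₀ : ℤ} (hm₀ : 0 < m₀) (hΔ : intDisc k₀ = m₀ ^ 2) :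
    stabK k₀ = ⊥ := by
  rw [Subgroup.eq_bot_iff_forall]
  intro γ hγ
  exact eq_one_of_smul_eq_of_sq hm₀ hΔ hγ

end Literature.NumberTheory.EllipticCurves.Shintani
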